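import Literature.NumberTheory.EllipticCurves.EisensteinNewformLevelRaising
import Literature.NumberTheory.EllipticCurves.EisensteinNewformLevelRaisingDictionaryProofs
import Literature.NumberTheory.EllipticCurves.EisensteinNewformLevelRaisingCoreProofs
import Literature.NumberTheory.EllipticCurves.EisensteinNewformLevelRaisingOddReductionProofs
import Literature.NumberTheory.EllipticCurves.EisensteinSeriesNebentypusLevelRaisedOddPrimeProofs
import HarnessLib

/-!
# Billerey–Menares 2016, Thm. 2.2 at every ODD prime (the rendering
# `BillereyMenares2016_thm22_exists_newform_odd`) from the Katz–Carayol lifting lemma (proofs only)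

Topic `Literature/NumberTheory/EllipticCurves`; namespace `Literature.NumberTheory.EllipticCurves`.
THEOREMS ONLY (no definition, no named fact; D-0026).  The odd-prime companion of
`EisensteinNewformLevelRaisingBM2016Proofs` (`BillereyMenares2016_thm22_of_cuspFormLift`, which
treats the rendering `BillereyMenares2016_thm22_exists_newform` at `p ≥ 5`).

`BillereyMenares2016_thm22_odd_of_cuspFormLift` proves the named fact
`Literature.NumberTheory.EllipticCurves.BillereyMenares2016_thm22_exists_newform_odd`
(`EisensteinNewformLevelRaising.lean`: N. Billerey, R. Menares, *On the modularity of reducible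
mod `l` Galois representations*, Math. Res. Lett. 23 (2016), §2, Thm. 2.2 with Prop. 1.2, at
every odd prime `l`; our `p` is their `l`, our `M` their level-raising prime `p`) from ONE
hypothesis, the lifting lemma of the printed proof (p. 7: "the reduction `F` of `E` modulo `λ` is
a cuspidal eigenform … According to [DeSe74] we can find a form `f ∈ S_k(Γ₀(Np), ε₀)` …"; in the
2018 sequel, §3.2: Carayol's lemma [Edixhoven, *Serre's conjecture*, in Cornell–Silverman–Stevens
1997, Prop. 1.10], resting on Katz' `q`-expansion principle and base change for cusp forms,
N. Katz, *p-adic properties of modular schemes and modular forms*, LNM 350 (1973), §1.7), here at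
an ODD prime `p`: for `p ∤ N`, `k ≥ 2`, a modular form `F ∈ M_k(Γ₁(N))` with nebentypus `χ` on
`Γ₀(N)`, `p`-integral `q`-expansion (through `ι : ℚ̄_p ≃ ℂ`) and constant terms in the maximal
ideal at every cusp is congruent modulo the maximal ideal to a cusp form `G ∈ S_k(N, χ)`.  That
lemma is not in the tree (it is the only missing ingredient, for BOTH renderings); everything else
is assembled here exactly as in the `p ≥ 5` file, the case `p = 3` (weights `k ∈ {3, 4}`) being
supplied by `exists_tendsto_eisensteinLevelRaised_slash_valuation_lt_one_odd`
(`EisensteinSeriesNebentypusLevelRaisedOddPrimeProofs`: `B_{3,χ} ∈ 3ℤ₍₃₎[χ]`, `B_{4,χ}`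
`3`-integral for `χ ≠ 𝟙`, and the von Staudt corner `(k, χ) = (4, 𝟙)` under `M² ≡ 1 (mod 9)`):

1. **dictionary** (`exists_dirichletCharacter_of_padicCharacter`, `p ≥ 3`): the reduction of `η`
   is `χ̃ ω^{k-1}` for a primitive Dirichlet character `χ` modulo `N`, `p ∤ N`, of parity `(-1)^k`
   and order prime to `p`, with `χ(ℓ)ℓ^{k-1} ≡ η(Frob_ℓ)`, `M ∤ N` and `χ(M)M^k ≡ 1`; the von
   Staudt clause of the fact (indexed by `(p - 1) ∣ k` and "`η ≡ χ_p^{k-1}` on all of `Γ_ℚ`")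
   yields the clause "`(p - 1) ∣ k`, `N = 1` ⟹ `M^{p-1} ≡ 1 (mod p²)`" of the constant-term
   theorem (`N = 1` forces `χ = 𝟙`, whence `η ≡ χ_p^{k-1}` globally by 3. of the dictionary);
2. **the level-raised Eisenstein series** `F₂ = eisensteinLevelRaised N k χ M` on `Γ₁(NM)`:
   nebentypus `χ` (`eisensteinLevelRaised_slash_of_mem_gamma0`), `p`-integral coefficients
   (`valuation_qExpansion_coeff_eisensteinLevelRaised_le_one_of_le`) and constant terms in `𝔪` at
   all cusps for every odd `p` and every Billerey–Menares weight
   (`exists_tendsto_eisensteinLevelRaised_slash_valuation_lt_one_odd`);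
3. **the lift** (the hypothesis) gives `G ∈ S_k(NM, χ)`, `G ≡ F₂ (mod 𝔪)`;
4. **Deligne–Serre + newform theory** (`exists_isNewform1_of_congruent_eisensteinLevelRaised`,
   any prime `p`): a newform `g` of level `N` or `NM` with `a_ℓ(g) ≡ 1 + χ(ℓ)ℓ^{k-1}`,
   `a_p(g) ≡ 1`, nebentypus of conductor `N`, order prime to `p`, values `χ(ℓ)`;
5. back to `η` through the dictionary's Frobenius congruences.

`BillereyMenares2016_thm22_both_of_cuspFormLift`: the same hypothesis therefore proves both
named facts (`BillereyMenares2016_thm22_exists_newform_of_odd`,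
`EisensteinNewformLevelRaisingOddReductionProofs`).

## References

* N. Billerey, R. Menares, *On the modularity of reducible mod `l` Galois representations*, Math.
  Res. Lett. 23 (2016), 15–41, §2, Thm. 2.2 (p. 7, stated for every prime `l`; weights p. 7),
  Prop. 1.2. [BillereyMenares2016]
* N. Billerey, R. Menares, *Strong modularity of reducible Galois representations*, Trans. AMS
  370 (2018), 967–986, §3.2. [BillereyMenares2018]
* B. Edixhoven, *Serre's conjecture*, in: Modular Forms and Fermat's Last Theorem (Cornell,
  Silverman, Stevens eds.), Springer 1997, 209–242, Prop. 1.10. [Edixhoven1997]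
* P. Deligne, J.-P. Serre, *Formes modulaires de poids 1*, Ann. Sci. ÉNS (4) 7 (1974), 507–530,
  Lemme 6.11. [DeligneSerreASENS1974]
-/

noncomputable section

open scoped MatrixGroups ModularForm Topology
open CongruenceSubgroup UpperHalfPlane Filter NumberField IsDedekindDomain Field

namespace Literature.NumberTheory.EllipticCurves

open Literature.NumberTheory.GaloisRepresentations
open Literature.NumberTheory.EllipticCurves.ModularForms

section Norm

variable {p : ℕ} [Fact p.Prime]

/-- `Valued.v x < 1 ↔ ‖x‖ < 1` in `ℚ̄_p`. [folklore] -/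
private theorem v_lt_one_iff₃ (x : PadicAlgCl p) : Valued.v x < 1 ↔ ‖x‖ < 1 := by
  rw [PadicAlgCl.valuation_def, ← NNReal.coe_lt_coe, coe_nnnorm, NNReal.coe_one]

/-- `Valued.v x ≤ 1 ↔ ‖x‖ ≤ 1` in `ℚ̄_p`. [folklore] -/
private theorem v_le_one_iff₃ (x : PadicAlgCl p) : Valued.v x ≤ 1 ↔ ‖x‖ ≤ 1 := by
  rw [PadicAlgCl.valuation_def, ← NNReal.coe_le_coe, coe_nnnorm, NNReal.coe_one]

/-- Chaining two congruences modulo `𝔪`. [folklore] -/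
private theorem norm_sub_lt_one_trans₃ {x y z : PadicAlgCl p} (h₁ : ‖x - y‖ < 1)
    (h₂ : ‖y - z‖ < 1) : ‖x - z‖ < 1 := by
  have : x - z = (x - y) + (y - z) := by ring
  rw [this]
  exact (PadicAlgCl.isNonarchimedean p _ _).trans_lt (max_lt h₁ h₂)

end Norm

/-- **Billerey–Menares 2016, Thm. 2.2 at every odd prime, from the Katz–Carayol lifting lemma.**
The hypothesis `hlift` is the lifting lemma of the printed proof (Edixhoven 1997, Prop. 1.10;
Billerey–Menares 2018, §3.2), stated for an odd prime `p`, `p ∤ N`, `k ≥ 2`: a modular form on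
`Γ₁(N)` with nebentypus `χ` on `Γ₀(N)`, `p`-integral `q`-expansion at `∞` and constant terms in
the maximal ideal at every cusp is congruent to a cusp form in `S_k(N, χ)`.  The conclusion is the
named fact `BillereyMenares2016_thm22_exists_newform_odd` verbatim (see the module docstring for
the assembly; the case `p = 3` differs from `p ≥ 5` only in the constant-term computation).
[cite: BillereyMenares2016, §2, Thm. 2.2 (p. 7); Prop. 1.2]
[cite: Edixhoven1997, Prop. 1.10] -/
theorem BillereyMenares2016_thm22_odd_of_cuspFormLift
    (hlift : ∀ (p : ℕ) [Fact p.Prime], p ≠ 2 → ∀ (ι : PadicAlgCl p ≃+* ℂ) (N : ℕ) [NeZero N],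
      ¬ p ∣ N → ∀ (k : ℤ), 2 ≤ k → ∀ (χ : DirichletCharacter ℂ N) (F : ModularForm (Gamma1 N) k),
      (∀ γ : SL(2, ℤ), γ ∈ Gamma0 N →
        (⇑F : ℍ → ℂ) ∣[k] γ = χ ((γ 1 1 : ℤ) : ZMod N) • (⇑F : ℍ → ℂ)) →
      (∀ n : ℕ, Valued.v (ι.symm ((qExpansion 1 ⇑F).coeff n)) ≤ 1) →
      (∀ γ : SL(2, ℤ), ∃ c : ℂ,
        Tendsto ((⇑F : ℍ → ℂ) ∣[k] γ) atImInfty (𝓝 c) ∧ Valued.v (ι.symm c) < 1) →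
      ∃ G : CuspForm (Gamma1 N) k, G ∈ nebentypusSubspace N k χ ∧
        ∀ n : ℕ, Valued.v (ι.symm ((qExpansion 1 ⇑G).coeff n - (qExpansion 1 ⇑F).coeff n)) < 1) :
    BillereyMenares2016_thm22_exists_newform_odd := by
  intro p _ hp2 ι ρ k M hunit hodd hkr hIp hMpr hMp hunr hFrobM hcorner
  have hp : p.Prime := Fact.out
  have hp3 : 3 ≤ p := by have := hp.two_le; omega
  have hk3 : 3 ≤ k := by rcases hkr with h | h | ⟨h, -⟩ <;> omega
  have hk1 : 1 ≤ k := by omega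
  -- ### (1) the dictionary
  have hIp' : ∃ w : HeightOneSpectrum (𝓞 ℚ), (p : 𝓞 ℚ) ∈ w.asIdeal ∧ ∃ 𝔓 ∈ w.primesAbove,
      ∀ σ ∈ 𝔓.inertia (absoluteGaloisGroup ℚ),
        Valued.v (((ρ σ : (PadicAlgCl p)ˣ) : PadicAlgCl p) -
          algebraMap (Padic p) (PadicAlgCl p)
            (((GaloisRep.cyclotomicCharacter ℚ p σ).val : PadicInt p) : Padic p) ^ (k - 1)) < 1 :=
    ⟨_, natCast_mem_asIdeal_primesEquiv_symm p hp,
      hIp _ (natCast_mem_asIdeal_primesEquiv_symm p hp)⟩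
  obtain ⟨N, _, χ, hχ, hpN, hpar, ⟨m, hm0, hpm, hχm⟩, hglob, hFrobχ, hMcl⟩ :=
    exists_dirichletCharacter_of_padicCharacter hp3 ι ρ hk1 hunit hodd hIp'
  obtain ⟨hMN, hcongM⟩ := hMcl M hMpr hMp hunr
  have hcong : Valued.v (ι.symm ((χ (M : ZMod N) : ℂ) * (M : ℂ) ^ (k : ℤ)) - 1) < 1 :=
    hcongM hFrobM
  haveI : NeZero M := ⟨hMpr.ne_zero⟩
  have hMNc : M.Coprime N := (Nat.Prime.coprime_iff_not_dvd hMpr).2 hMN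
  have hpM : ¬ p ∣ M := fun h ↦ hMp ((Nat.prime_dvd_prime_iff_eq hp hMpr).1 h).symm
  have hpL : ¬ p ∣ N * M := fun h ↦ (hp.dvd_mul.1 h).elim hpN hpM
  -- `M^{p-1} ≡ 1 (mod p²)` in the von Staudt corner `(p - 1) ∣ k`, `N = 1` (so `χ = 𝟙` and
  -- `η ≡ χ_p^{k-1}` on all of `Γ_ℚ`)
  have hvs : (p - 1) ∣ k → N = 1 → M ^ (p - 1) % p ^ 2 = 1 := by
    intro hdvd hN1
    have hχ1 : χ = 1 := DirichletCharacter.level_one' χ hN1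
    refine hcorner hdvd fun τ ↦ ?_
    have h := hglob τ
    rw [hχ1, MulChar.one_apply_coe, map_one, one_mul, Valuation.map_sub_swap] at h
    exact h
  -- ### (2) the level-raised Eisenstein series and the hypotheses of the lift
  set F := eisensteinLevelRaised N k χ M hk3 with hF
  set χ' : DirichletCharacter ℂ (N * M) := DirichletCharacter.changeLevel (dvd_mul_right N M) χ
    with hχ'
  have hslash : ∀ γ : SL(2, ℤ), γ ∈ Gamma0 (N * M) →
      (⇑F : ℍ → ℂ) ∣[((k : ℕ) : ℤ)] γ = χ' ((γ 1 1 : ℤ) : ZMod (N * M)) • (⇑F : ℍ → ℂ) := by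
    intro γ hγ
    rw [hF, eisensteinLevelRaised_slash_of_mem_gamma0 k χ M hk3 hγ]
    congr 1
    have hu := isUnit_gamma0_apply_one_one hγ
    rw [hχ', ← hu.unit_spec, DirichletCharacter.changeLevel_eq_cast_of_dvd χ (dvd_mul_right N M),
      hu.unit_spec, ZMod.cast_intCast (dvd_mul_right N M)]
  have hint : ∀ n : ℕ, Valued.v (ι.symm ((qExpansion 1 ⇑F).coeff n)) ≤ 1 := fun n ↦
    valuation_qExpansion_coeff_eisensteinLevelRaised_le_one_of_le k χ M ι hk3 hχ hpar n
  have hcusps : ∀ γ : SL(2, ℤ), ∃ c : ℂ,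
      Tendsto ((⇑F : ℍ → ℂ) ∣[((k : ℕ) : ℤ)] γ) atImInfty (𝓝 c) ∧ Valued.v (ι.symm c) < 1 :=
    fun γ ↦ exists_tendsto_eisensteinLevelRaised_slash_valuation_lt_one_odd k χ M ι hp2 hpN hχ
      hk3 hkr hMpr hMp hMNc hcong hvs γ
  -- ### (3) the lift
  obtain ⟨G, hGχ, hGF⟩ := hlift p hp2 ι (N * M) hpL (k : ℤ) (by exact_mod_cast (show 2 ≤ k by omega))
    χ' F hslash hint hcusps
  -- ### (4) Deligne–Serre and the newform
  have hGF' : ∀ n, ‖ι.symm (cuspCoeff G n - (qExpansion 1 ⇑F).coeff n)‖ < 1 := fun n ↦ by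
    rw [← v_lt_one_iff₃]; exact hGF n
  have hGint : ∀ n, ‖ι.symm (cuspCoeff G n)‖ ≤ 1 := by
    intro n
    have h1 := hGF' n
    have h2 : ‖ι.symm ((qExpansion 1 ⇑F).coeff n)‖ ≤ 1 := by rw [← v_le_one_iff₃]; exact hint n
    have h3 : ι.symm (cuspCoeff G n) = ι.symm (cuspCoeff G n - (qExpansion 1 ⇑F).coeff n) +
        ι.symm ((qExpansion 1 ⇑F).coeff n) := by rw [← map_add, sub_add_cancel]
    rw [h3]
    exact (PadicAlgCl.isNonarchimedean p _ _).trans (max_le h1.le h2)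
  obtain ⟨N', _, g, hnew, hpN', hN', hcond, hgm, hgood, hap⟩ :=
    exists_isNewform1_of_congruent_eisensteinLevelRaised ι hk3 hχ hpar hpN hpm hχm hMpr hMp hMN
      hGχ hGint hGF'
  have hNN' : N ∣ N' := by rcases hN' with rfl | rfl; exacts [dvd_rfl, dvd_mul_right N M]
  -- ### (5) back to `η`
  refine ⟨N', ‹_›, g, hnew, hpN', ?_, ⟨m, hm0, hpm, hgm⟩, ?_, ?_⟩
  · rcases hN' with rfl | rfl
    · exact Or.inl hcond.symm
    · exact Or.inr (by rw [hcond])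
  · rw [v_lt_one_iff₃]; exact hap
  · intro ℓ hℓ hℓN' hℓp w hw 𝔓 h𝔓 σ hσ
    have hℓN : ¬ ℓ ∣ N := fun h ↦ hℓN' (h.trans hNN')
    obtain ⟨h1, h2⟩ := hgood ℓ hℓ hℓN'
    have h3 := hFrobχ ℓ hℓ hℓN hℓp w hw 𝔓 h𝔓 σ hσ
    rw [v_lt_one_iff₃] at h3
    have hzpow : ((ℓ : ℂ)) ^ ((k : ℤ) - 1) = (ℓ : ℂ) ^ (k - 1) := by
      rw [show ((k : ℤ) - 1) = ((k - 1 : ℕ) : ℤ) by omega, zpow_natCast]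
    refine ⟨?_, ?_⟩
    · rw [v_lt_one_iff₃]
      refine norm_sub_lt_one_trans₃ h1 ?_
      rw [add_sub_add_left_eq_sub, ← hzpow]
      exact h3
    · rw [v_lt_one_iff₃, h2]
      exact h3

/-- **Both renderings of Billerey–Menares 2016, Thm. 2.2, from the one lifting lemma at odd
primes.**  The odd-prime fact implies the fact at `p ≥ 5`
(`BillereyMenares2016_thm22_exists_newform_of_odd`), so the Katz–Carayol lifting lemma at odd
primes (the hypothesis of `BillereyMenares2016_thm22_odd_of_cuspFormLift`) discharges
`BillereyMenares2016_thm22_exists_newform_odd` and `BillereyMenares2016_thm22_exists_newform`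
together. [cite: BillereyMenares2016, §2, Thm. 2.2 (p. 7)] -/
theorem BillereyMenares2016_thm22_both_of_cuspFormLift
    (hlift : ∀ (p : ℕ) [Fact p.Prime], p ≠ 2 → ∀ (ι : PadicAlgCl p ≃+* ℂ) (N : ℕ) [NeZero N],
      ¬ p ∣ N → ∀ (k : ℤ), 2 ≤ k → ∀ (χ : DirichletCharacter ℂ N) (F : ModularForm (Gamma1 N) k),
      (∀ γ : SL(2, ℤ), γ ∈ Gamma0 N →
        (⇑F : ℍ → ℂ) ∣[k] γ = χ ((γ 1 1 : ℤ) : ZMod N) • (⇑F : ℍ → ℂ)) →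
      (∀ n : ℕ, Valued.v (ι.symm ((qExpansion 1 ⇑F).coeff n)) ≤ 1) →
      (∀ γ : SL(2, ℤ), ∃ c : ℂ,
        Tendsto ((⇑F : ℍ → ℂ) ∣[k] γ) atImInfty (𝓝 c) ∧ Valued.v (ι.symm c) < 1) →
      ∃ G : CuspForm (Gamma1 N) k, G ∈ nebentypusSubspace N k χ ∧
        ∀ n : ℕ, Valued.v (ι.symm ((qExpansion 1 ⇑G).coeff n - (qExpansion 1 ⇑F).coeff n)) < 1) :
    BillereyMenares2016_thm22_exists_newform_odd ∧ BillereyMenares2016_thm22_exists_newform :=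
  ⟨BillereyMenares2016_thm22_odd_of_cuspFormLift hlift,
    BillereyMenares2016_thm22_exists_newform_of_odd
      (BillereyMenares2016_thm22_odd_of_cuspFormLift hlift)⟩

end Literature.NumberTheory.EllipticCurves
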